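import Literature.MathematicalPhysics.QuantumFieldTheory.Balaban1983to89.InfiniteVolumeSufficientXIX
import HarnessLib

/-!
# Sufficient conditions for the infinite-volume limit, XX — THE LASSO REPRESENTATION, AND LÉVY'S DENSITY FOR
TRACE-SEPARATING (ABELIAN) REPRESENTATIONS

Module XX of the `Balaban1983to89` audit package (infinite-volume angle: what uniformity in the volume the
renormalisation-group bounds of [Bal83–89] do and do not give, and the exact missing estimate).  A LEAF above module
XIX.  Module XIX reduced the target `(3a)` (`HasUniqueInfiniteVolumeLimit ρ β`: all subsequential infinite-volume limits
of the torus Wilson states coincide) to the convergence of the WILSON-LOOP CORRELATIONS `(W-corr)`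
(`HasWilsonLoopCorrelationLimits ρ d β`) UNDER ONE HYPOTHESIS, the density schema
`SpansGaugeInvariantCylinders d (wilsonLoopProducts ρ d)` (the SHAPE of T. Lévy's theorem, J. Geom. Phys. 52 (2004)
Thm 3.1).  This module answers the successor item §24.5 (T-Lévy) of `ir/SUFFICIENT.md`:

* it PROVES the purely combinatorial half of Lévy's argument on `ℤ^d` for EVERY group — the LASSO REPRESENTATION
  (`PART A`): a gauge-invariant function of the configuration is a function of the holonomies of the lassos based at
  the origin (Lévy 2004, proof of Prop. 3.5: "for every vertex `w` choose a path joining `w` to `v`"; the word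
  "lasso" is Driver's, J. Funct. Anal. 83 (1989), as cited in Chatterjee arXiv:1803.01950, ref. [driver89a]);
* it ISOLATES the representation-theoretic half as a several-variable schema `TraceWordsDense ρ` (`PART C`; the SHAPE
  of Lévy 2004 Prop. 3.4 / Sengupta 1994 Thm 2: continuous functions of finitely many group elements invariant under
  SIMULTANEOUS conjugation are uniformly approximable by polynomials in the real and imaginary parts of traces of
  words) and proves the kernel implication `TraceWordsDense ρ → SpansGaugeInvariantCylinders d (wilsonLoopProducts ρ d)`
  for every `d` and every `G` (`spansGaugeInvariantCylinders_of_traceWordsDense`);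
* it PROVES the schema, by the real Stone–Weierstrass theorem (Mathlib), for every continuous representation whose
  CHARACTER SEPARATES POINTS (`Function.Injective fun g => (ρ g).trace`; `PART D`) — in particular for the defining
  representation `u1Rep` of `U(1) = Circle` — so that module XIX's conditional headline becomes UNCONDITIONAL there
  (`PART E`): for compact abelian `U(1)` lattice gauge theory in any dimension and at every real `β`,
  `(3a) ⟺ (W-corr)`, and even `(3a) ⟺ (W-single)` (`PART F`: for one-dimensional unitary `ρ` the products of loop
  traces are themselves combinations of single loop traces, so the convergence of the SINGLE Wilson-loop expectations
  `⟨Re/Im U(ℓ)⟩_{𝕋_L,β}` as `L → ∞` is already equivalent to `(3a)`);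
* it records two NEGATIVE census witnesses (`PART G`): the density schema is NOT automatic — it fails for the trivial
  representation, and it fails for the FAITHFUL two-dimensional real representation `so2Rep` of `U(1)` (rotation
  matrices, trace `2 Re z`): every Wilson-loop product in that representation is invariant under the global inversion
  `U ↦ U⁻¹`, while the gauge-invariant cylinder `Im U_p` is odd.  Faithfulness of `ρ` is therefore NOT the right
  hypothesis; separation of points by the character is.  (Lévy 2004, abstract: "if `G` is orthogonal, unitary or
  symplectic, then Wilson loops associated to the natural representation of `G` are enough" — by this kernel witness
  that sentence holds for the FULL orthogonal group `O(2)`, under which `U ↦ U⁻¹` is the constant gauge transformation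
  by a reflection, and NOT for the special orthogonal group `SO(2) ≅ U(1)` acting by rotations; Sengupta 1994 Thm 2
  (p.900) is for `G` «a product of groups from the following list : abelian groups, the unitary groups U(n), special
  unitary groups SU(n), orthogonal groups O(n), and the odd special orthogonal groups SO(2n + 1)» — `O(n)` but no
  even `SO(2n)`; the symplectic groups enter with Lévy 2004, not with Sengupta.)

Nothing is cited as a fact: every statement below is a theorem over the tree's definitions, or a `Prop`-valued schema
used only as a hypothesis (ABSOLUTE RULE of the package: no internally minted statement enters as a cited fact;
`[cite: …]` tags mark the SHAPE or STATUS of a statement in print, never a borrowed proof step).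

## (1) THE LASSO REPRESENTATION (`PART A`)

For every site `x` of `ℤ^d` fix a nearest-neighbour walk `pathFromOrigin x : 0 ⤳ x` (the tree's
`zdGraph_reachable`).  The LASSO of the positively oriented edge `e = (x, i)` is the closed walk
`lasso e = (0 ⤳ x) · (x → x + eᵢ) · (x + eᵢ ⤳ 0)` based at the origin, and `lassoConfig U e := hol_U(lasso e)`.
KEY IDENTITY (`gaugeTransformZd_lassoGauge`): the configuration of lasso holonomies IS a gauge transform of `U`,
namely by the "axial" gauge function `lassoGauge U x = hol_U(0 ⤳ x)`:
`(U^{lassoGauge U})(x,i) = hol(0 ⤳ x) · U(x,i) · hol(0 ⤳ x+eᵢ)⁻¹ = hol(lasso (x,i))`.  Hence every gauge-invariant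
`F` satisfies `F U = F (lassoConfig U)` (`eq_lassoConfig_of_isZdGaugeInvariant`), and a gauge-invariant `S`-cylinder is
`F U = f (hol_U(lasso e))_{e ∈ S}` with `f = cylSlice F S` (the restriction of `F` to configurations equal to `1` off
`S`), a continuous function of finitely many group elements invariant under simultaneous conjugation
(`eq_cylSlice_lasso`, `continuous_cylSlice`, `cylSlice_conj`).

## (2) WORDS IN LASSOS ARE LOOPS (`PART B`)

A word in the letters `e^{±1}`, `e ∈ S`, evaluated at the lasso holonomies is the holonomy of a genuine loop at the
origin (`wordLasso`, `walkHolonomy_wordLasso`), so every polynomial in the real/imaginary parts of traces of such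
words, precomposed with `lassoConfig`, is an element of module XIX's class `wilsonLoopProducts ρ d`
(`traceWordProduct_lassoConfig_mem`).

## (3) THE SEVERAL-VARIABLE DENSITY SCHEMA AND THE REDUCTION (`PART C`)

`Missing.TraceWordsDense ρ`: for every finite index type `ι`, every continuous `f : (ι → G) → ℝ` invariant under
simultaneous conjugation is, for every `ε > 0`, within `ε` of an element of the real span of the finite products of
`V ↦ Re/Im tr ρ(w(V))`, `w` a word in the `V_i^{±1}` (the SHAPE of Lévy 2004 Prop. 3.4 + Stone–Weierstrass, resp. of the
first fundamental theorem of invariant theory for `U(N)`; NOT formalised for non-abelian `G`).  KERNEL THEOREM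
`spansGaugeInvariantCylinders_of_traceWordsDense`: `TraceWordsDense ρ → SpansGaugeInvariantCylinders d
(wilsonLoopProducts ρ d)` for every `d` and `G` — the lattice-combinatorial part of Lévy's theorem is thereby PROVED
on `ℤ^d`, and exactly the invariant-theoretic part remains a hypothesis.

## (4) PROOF OF THE SCHEMA FOR TRACE-SEPARATING REPRESENTATIONS (`PART D`)

If `ρ` is continuous and `g ↦ tr ρ(g)` is injective (e.g. `G = U(1)`, `ρ = u1Rep`; more generally any compact ABELIAN
group with a faithful one-dimensional representation), the unital real subalgebra of `C(ι → G, ℝ)` generated by the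
coordinate functions `V ↦ Re tr ρ(V_i)`, `V ↦ Im tr ρ(V_i)` separates points of the compact space `ι → G`, so by the
real Stone–Weierstrass theorem (Mathlib `ContinuousMap.exists_mem_subalgebra_near_continuous_of_separatesPoints`) it is
uniformly dense in ALL continuous functions (conjugation invariance is not even needed): `traceWordsDense_of_trace_injective`.

## (5) HEADLINES (`PART E`, `PART F`)

`hasUniqueInfiniteVolumeLimit_iff_hasWilsonLoopCorrelationLimits_of_trace_injective`: for continuous `ρ` with
injective character, `(3a) ⟺ (W-corr)` at every real `β` in every dimension `d`; instance
`hasUniqueInfiniteVolumeLimit_iff_hasWilsonLoopCorrelationLimits_u1` for `U(1)`.  For ONE-DIMENSIONAL unitary `ρ`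
(`N = 1`), `loopFactor`-products reduce to single `loopFactor`s (`2 Re a Re b = Re(ab) + Re(ab̄)` etc., with `ab`,
`ab̄` the traces of the concatenated loops `ℓ₁ · γ · ℓ₂^{±1} · γ⁻¹` transported to a common base point;
`loopFactor_mul_loopFactor_mem_span`), whence `(3a) ⟺ (W-single)` (`HasWilsonLoopLimits`: every single loop
expectation `⟨Re/Im tr ρ(U_ℓ)⟩_{𝕋_{L+1},β}` converges; `hasUniqueInfiniteVolumeLimit_iff_hasWilsonLoopLimits_u1`).
THE EXACT MISSING ESTIMATE for compact `U(1)` in `d` dimensions at coupling `β` is therefore: for every lattice loop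
`ℓ`, the torus expectations `⟨cos θ(ℓ)⟩_{𝕋_L,β}`, `⟨sin θ(ℓ)⟩_{𝕋_L,β}` form a CAUCHY sequence in the torus
size `L`.

## (6) CENSUS NEGATIVES (`PART G`)

`not_spansGaugeInvariantCylinders_trivial`: for the trivial representation of `U(1)` every Wilson-loop product is
constant, and the gauge-invariant cylinder `Im U_p` is not within `1/4` of a constant (`d ≥ 2`).
`not_spansGaugeInvariantCylinders_so2Rep`: for the faithful real `2 × 2` representation `so2Rep` of `U(1)` every
Wilson-loop product is invariant under `U ↦ U⁻¹` (abelian holonomy inverts, `tr so2Rep(z⁻¹) = tr so2Rep(z)`, imaginary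
parts vanish), and `Im U_p` is odd with value `1` somewhere, so it is not within `1/2` of the span; consequently
`¬ TraceWordsDense so2Rep` (`not_traceWordsDense_so2Rep`).  So: (i) the density schema has content; (ii) "faithful"
is not the right hypothesis, "character separates points" is.

Sources.  T. Lévy, J. Geom. Phys. 52 (2004) 382–397 = arXiv:math-ph/0306059: §2 (Wilson loops `W_{α,l} = χ_α ∘ h_l`,
Remark 2.4: functions `f ∘ (h_{l_1}, …, h_{l_n})` of several loops at one base point with `f` invariant by diagonal
adjunction), Thm 3.1, Props 3.4–3.6 (reduction to the bouquet graphs `L_r` by paths to a base vertex; conclusion by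
Stone–Weierstrass) [Levy2004]; A. Sengupta, Proc. AMS 121 (1994) 897–905, Thm 2 p.900 [Sengupta1994]; S. Chatterjee,
arXiv:1803.01950 §2 (infinite-volume limits on local observables) [arXiv180301950]; B. Driver, J. Funct. Anal. 83
(1989) 185–231 (lassos; terminology only).  Mathlib: `ContinuousMap.exists_mem_subalgebra_near_continuous_of_separatesPoints`
(real Stone–Weierstrass), `Algebra.adjoin_induction`, `Submodule.span_mul_span`.

VERSIONS: v1 (gen 20, p191503).  v1.1 (gen 21): DOCFIX D-XX-1 (XREAD C-strat18-7) = D-1 (XREAD C-pv22g21-2),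
docstrings only — Sengupta 1994 Thm 2's list of groups corrected in the header, in the docstring of `TraceWordsDense`
and in that of `not_spansGaugeInvariantCylinders_so2Rep` (print, p.900: abelian groups, `U(n)`, `SU(n)`, `O(n)`,
`SO(2n+1)`; no symplectic groups, which enter with Lévy 2004), locator `Thm 2 p.900` (the article begins on p.897);
no declaration changed.  Sequel: module XXI (`InfiniteVolumeSufficientXXI`) proves `TraceWordsDense` for `SU(2)`.
-/

namespace Literature.MathematicalPhysics.QuantumFieldTheory

open MeasureTheory Filter Topology
open scoped Pointwise
open Literature.MathematicalPhysics.QuantumLattice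
open Literature.Probability.LatticeModels (Torus.proj zdGraph zdGraph_reachable)
open Balaban1983to89.Missing (SpansGaugeInvariantCylinders HasWilsonLoopCorrelationLimits)

-- Sites of `ℤ^d` are written `Fin d → ℤ` (= the tree's `Literature.Probability.LatticeModels.Site d`, an `abbrev`).

/-! ## PART A — THE LASSO REPRESENTATION OF GAUGE-INVARIANT FUNCTIONS -/

section Lasso

variable {d : ℕ} {G : Type*} [Group G]

/-- A fixed nearest-neighbour walk of `ℤ^d` from the origin to `x` (a choice from the tree's `zdGraph_reachable`;
which walk is immaterial for everything below). [folklore] -/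
noncomputable def pathFromOrigin (x : Fin d → ℤ) : (zdGraph d).Walk (0 : Fin d → ℤ) x :=
  (zdGraph_reachable (0 : Fin d → ℤ) x).some

/-- The one-step walk `x → x + eᵢ` along the positively oriented edge `e = (x, i)`. [folklore] -/
def edgeWalk (e : ZdEdge d) : (zdGraph d).Walk e.1 (e.1 + Pi.single e.2 1) :=
  SimpleGraph.Walk.cons (zdGraph_adj_add_single e.1 e.2) SimpleGraph.Walk.nil

/-- The holonomy of the one-step walk along `e` is `U e`. [folklore] -/
@[simp] theorem walkHolonomy_edgeWalk (U : LGConfig d G) (e : ZdEdge d) : walkHolonomy U (edgeWalk e) = U e := by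
  simp only [edgeWalk, walkHolonomy_cons, walkHolonomy_nil, mul_one, dartHolonomy_add_single, Prod.mk.eta]

/-- THE LASSO of the edge `e = (x, i)`: the closed walk `0 ⤳ x → x + eᵢ ⤳ 0` based at the origin, going out along
`pathFromOrigin x`, across `e`, and back along the reverse of `pathFromOrigin (x + eᵢ)` (Lévy 2004, proof of
Prop. 3.5; Driver's "lassos"). [cite: Levy2004, Prop 3.5] -/
noncomputable def lasso (e : ZdEdge d) : (zdGraph d).Walk (0 : Fin d → ℤ) 0 :=
  (pathFromOrigin e.1).append ((edgeWalk e).append (pathFromOrigin (e.1 + Pi.single e.2 1)).reverse)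

/-- The AXIAL (lasso) gauge function of `U`: `x ↦ hol_U(0 ⤳ x)`. [cite: Levy2004, Prop 3.5] -/
noncomputable def lassoGauge (U : LGConfig d G) (x : Fin d → ℤ) : G := walkHolonomy U (pathFromOrigin x)

/-- The configuration of LASSO HOLONOMIES of `U`: `e ↦ hol_U(lasso e)`. [cite: Levy2004, Prop 3.5] -/
noncomputable def lassoConfig (U : LGConfig d G) : LGConfig d G := fun e => walkHolonomy U (lasso e)

/-- `hol(lasso (x,i)) = hol(0 ⤳ x) · U(x,i) · hol(0 ⤳ x + eᵢ)⁻¹`. [folklore] -/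
theorem walkHolonomy_lasso (U : LGConfig d G) (e : ZdEdge d) :
    walkHolonomy U (lasso e) = lassoGauge U e.1 * U e * (lassoGauge U (e.1 + Pi.single e.2 1))⁻¹ := by
  simp only [lasso, lassoGauge, walkHolonomy_append, walkHolonomy_reverse, walkHolonomy_edgeWalk, mul_assoc]

/-- **KEY IDENTITY.** Gauge-transforming `U` by its own axial gauge function produces the configuration of lasso
holonomies: `U^{lassoGauge U} = lassoConfig U`. [cite: Levy2004, Prop 3.5] -/
theorem gaugeTransformZd_lassoGauge (U : LGConfig d G) : gaugeTransformZd (lassoGauge U) U = lassoConfig U := by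
  funext e
  simp only [gaugeTransformZd, lassoConfig, walkHolonomy_lasso]

/-- **THE LASSO REPRESENTATION.** A gauge-invariant function of the configuration is a function of the lasso
holonomies: `F U = F (lassoConfig U)`. [cite: Levy2004, Prop 3.5] -/
theorem eq_lassoConfig_of_isZdGaugeInvariant {α : Type*} {F : LGConfig d G → α} (hF : IsZdGaugeInvariant F)
    (U : LGConfig d G) : F U = F (lassoConfig U) := by
  rw [← gaugeTransformZd_lassoGauge, hF]

/-- Two configurations with the same lasso holonomies are not distinguished by any gauge-invariant function.
[cite: Levy2004, Prop 3.5] -/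
theorem eq_of_lassoConfig_eq {α : Type*} {F : LGConfig d G → α} (hF : IsZdGaugeInvariant F) {U V : LGConfig d G}
    (h : lassoConfig U = lassoConfig V) : F U = F V := by
  rw [eq_lassoConfig_of_isZdGaugeInvariant hF U, eq_lassoConfig_of_isZdGaugeInvariant hF V, h]

/-! ### Slices of cylinder functions: functions of finitely many group elements -/

/-- Extension by `1`: the configuration equal to `V` on the finite edge set `S` and to `1` off `S`. [folklore] -/
def extendOne (S : Finset (ZdEdge d)) (V : ↥S → G) : LGConfig d G := fun e => if h : e ∈ S then V ⟨e, h⟩ else 1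

/-- `extendOne S V e = V e` on `S`. [folklore] -/
@[simp] theorem extendOne_apply_mem (S : Finset (ZdEdge d)) (V : ↥S → G) (e : ↥S) :
    extendOne S V (e : ZdEdge d) = V e := by
  simp [extendOne, e.2]

/-- `extendOne S V e = 1` off `S`. [folklore] -/
theorem extendOne_apply_not_mem (S : Finset (ZdEdge d)) (V : ↥S → G) {e : ZdEdge d} (he : e ∉ S) :
    extendOne S V e = 1 := by
  simp [extendOne, he]

/-- The SLICE of `F` along `S`: `F` as a function of the finitely many variables `(U_e)_{e ∈ S}`, the other edges
set to `1` (Lévy 2004 Remark 2.4: the function `f` of several group elements). [cite: Levy2004, Remark 2.4] -/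
def cylSlice {α : Type*} (F : LGConfig d G → α) (S : Finset (ZdEdge d)) (V : ↥S → G) : α := F (extendOne S V)

/-- An `S`-cylinder is its slice evaluated at the restriction: `F U = cylSlice F S (U|_S)`. [folklore] -/
theorem eq_cylSlice_of_isCylinder {α : Type*} {F : LGConfig d G → α} {S : Finset (ZdEdge d)} (hF : IsCylinder F S)
    (U : LGConfig d G) : F U = cylSlice F S fun e => U e :=
  hF fun e he => by
    rw [Finset.mem_coe] at he
    simp [extendOne, he]

/-- **THE LASSO REPRESENTATION OF A GAUGE-INVARIANT CYLINDER**: `F U = f (hol_U(lasso e))_{e ∈ S}` with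
`f = cylSlice F S` (Lévy 2004 Remark 2.4 and Prop. 3.5). [cite: Levy2004, Remark 2.4] -/
theorem eq_cylSlice_lasso {α : Type*} {F : LGConfig d G → α} {S : Finset (ZdEdge d)} (hFS : IsCylinder F S)
    (hF : IsZdGaugeInvariant F) (U : LGConfig d G) :
    F U = cylSlice F S fun e : ↥S => walkHolonomy U (lasso (e : ZdEdge d)) := by
  rw [eq_lassoConfig_of_isZdGaugeInvariant hF U, eq_cylSlice_of_isCylinder hFS]
  rfl

/-- Simultaneous conjugation of the slice variables is a CONSTANT gauge transformation of the extended
configuration. [folklore] -/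
theorem extendOne_conj (S : Finset (ZdEdge d)) (V : ↥S → G) (g : G) :
    extendOne S (fun e => g * V e * g⁻¹) = gaugeTransformZd (fun _ => g) (extendOne S V) := by
  funext e
  by_cases h : e ∈ S <;> simp [extendOne, gaugeTransformZd, h]

/-- The slice of a gauge-invariant function is invariant under SIMULTANEOUS CONJUGATION of its variables (Lévy 2004
Remark 2.4: "invariant by diagonal adjunction"). [cite: Levy2004, Remark 2.4] -/
theorem cylSlice_conj {α : Type*} {F : LGConfig d G → α} (hF : IsZdGaugeInvariant F) (S : Finset (ZdEdge d))
    (V : ↥S → G) (g : G) : cylSlice F S (fun e => g * V e * g⁻¹) = cylSlice F S V := by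
  rw [cylSlice, cylSlice, extendOne_conj]
  exact hF _ _

variable [TopologicalSpace G]

/-- Extension by `1` is continuous (product topologies). [folklore] -/
theorem continuous_extendOne (S : Finset (ZdEdge d)) : Continuous (extendOne (G := G) S) := by
  refine continuous_pi fun e => ?_
  by_cases h : e ∈ S
  · simp only [extendOne, h, dite_true]
    exact continuous_apply _
  · simp only [extendOne, h, dite_false]
    exact continuous_const

/-- The slice of a continuous function is continuous. [folklore] -/
theorem continuous_cylSlice {α : Type*} [TopologicalSpace α] {F : LGConfig d G → α} (hF : Continuous F)
    (S : Finset (ZdEdge d)) : Continuous (cylSlice F S) :=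
  hF.comp (continuous_extendOne S)

end Lasso

/-! ## PART B — WORDS, TRACE WORDS, AND WORDS IN LASSOS -/

section Words

variable {G : Type*} [Group G]

/-- The value of the letter `(i, ±)` at `V`: `V i` or `(V i)⁻¹`. [folklore] -/
def letterVal {ι : Type*} (V : ι → G) (a : ι × Bool) : G := if a.2 then V a.1 else (V a.1)⁻¹

/-- The value `w(V) = ∏_{(i,±) ∈ w} V_i^{±1}` (ordered product) of the word `w` at `V` (Lévy 2004 Example 3.3).
[cite: Levy2004, Example 3.3] -/
def wordVal {ι : Type*} (w : List (ι × Bool)) (V : ι → G) : G := (w.map (letterVal V)).prod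

/-- `wordVal [] V = 1`. [folklore] -/
@[simp] theorem wordVal_nil {ι : Type*} (V : ι → G) : wordVal [] V = 1 := by simp [wordVal]

/-- `wordVal (a :: w) V = letterVal V a * wordVal w V`. [folklore] -/
@[simp] theorem wordVal_cons {ι : Type*} (a : ι × Bool) (w : List (ι × Bool)) (V : ι → G) :
    wordVal (a :: w) V = letterVal V a * wordVal w V := by simp [wordVal]

/-- Re-indexing a word along `φ : ι → κ` evaluates it at `V ∘ φ`. [folklore] -/
theorem wordVal_map {ι κ : Type*} (φ : ι → κ) (w : List (ι × Bool)) (V : κ → G) :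
    wordVal (w.map fun a => (φ a.1, a.2)) V = wordVal w (V ∘ φ) := by
  induction w with
  | nil => simp
  | cons a w ih => simp [ih, letterVal]

/-- Simultaneous conjugation of the variables conjugates the value of every word. [folklore] -/
theorem wordVal_conj {ι : Type*} (w : List (ι × Bool)) (V : ι → G) (g : G) :
    wordVal w (fun i => g * V i * g⁻¹) = g * wordVal w V * g⁻¹ := by
  induction w with
  | nil => simp
  | cons a w ih =>
    rw [wordVal_cons, wordVal_cons, ih]
    rcases a with ⟨i, _ | _⟩ <;> simp [letterVal, mul_assoc]

variable {N : ℕ} (ρ : G →* Matrix (Fin N) (Fin N) ℂ)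

/-- The real (`true`) or imaginary (`false`) part of the character `tr ρ`. [folklore] -/
def tracePart : Bool → G → ℝ
  | true => fun g => (ρ g).trace.re
  | false => fun g => (ρ g).trace.im

/-- Module XIX's generators through `tracePart`: `loopFactor ρ (ℓ, b) = tracePart ρ b ∘ hol(ℓ)`. [folklore] -/
theorem loopFactor_eq_tracePart {d : ℕ} (ℓ : Σ x : (Fin d → ℤ), (zdGraph d).Walk x x) (b : Bool) (U : LGConfig d G) :
    loopFactor ρ (ℓ, b) U = tracePart ρ b (walkHolonomy U ℓ.2) := by
  cases b <;> rfl

/-- `tracePart ρ b` is a class function (cyclicity of the trace). [folklore] -/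
theorem tracePart_conj (b : Bool) (g h : G) : tracePart ρ b (g * h * g⁻¹) = tracePart ρ b h := by
  have htr : (ρ (g * h * g⁻¹)).trace = (ρ h).trace := by
    rw [map_mul, map_mul, Matrix.trace_mul_cycle, ← map_mul, inv_mul_cancel, map_one, one_mul]
  cases b <;> simp only [tracePart] <;> rw [htr]

/-- A finite PRODUCT OF TRACE WORDS: `V ↦ ∏ₖ Re/Im tr ρ(wₖ(V))` (`1` for the empty list). [cite: Levy2004, Prop 3.4] -/
def traceWordProduct {ι : Type*} (l : List (List (ι × Bool) × Bool)) (V : ι → G) : ℝ :=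
  (l.map fun p => tracePart ρ p.2 (wordVal p.1 V)).prod

/-- The class of all finite products of trace words in the variables indexed by `ι`. [cite: Levy2004, Prop 3.4] -/
def traceWordProducts (ι : Type*) : Set ((ι → G) → ℝ) := Set.range (traceWordProduct (ι := ι) ρ)

/-- `traceWordProduct ρ [] = 1`. [folklore] -/
@[simp] theorem traceWordProduct_nil {ι : Type*} : traceWordProduct (ι := ι) ρ [] = fun _ => 1 := by
  funext V; simp [traceWordProduct]

/-- `traceWordProduct ρ (p :: l) = (tracePart ρ p.2 ∘ wordVal p.1) * traceWordProduct ρ l`. [folklore] -/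
@[simp] theorem traceWordProduct_cons {ι : Type*} (p : List (ι × Bool) × Bool) (l : List (List (ι × Bool) × Bool)) :
    traceWordProduct ρ (p :: l) = fun V => tracePart ρ p.2 (wordVal p.1 V) * traceWordProduct ρ l V := by
  funext V; simp [traceWordProduct]

/-- Products of trace words are closed under multiplication (concatenate the lists). [folklore] -/
theorem traceWordProduct_append {ι : Type*} (l₁ l₂ : List (List (ι × Bool) × Bool)) :
    traceWordProduct ρ (l₁ ++ l₂) = traceWordProduct ρ l₁ * traceWordProduct ρ l₂ := by
  funext V; simp [traceWordProduct, List.map_append, List.prod_append]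

/-- A single trace of a single letter is a (one-factor) product of trace words. [folklore] -/
theorem tracePart_apply_mem_traceWordProducts {ι : Type*} (i : ι) (b : Bool) :
    (fun V : ι → G => tracePart ρ b (V i)) ∈ traceWordProducts ρ ι :=
  ⟨[([(i, true)], b)], by funext V; simp [traceWordProduct, letterVal]⟩

/-- In an algebra, the span of a multiplicatively closed set is closed under multiplication. [folklore] -/
theorem mul_mem_span_of_mul_closed {R A : Type*} [CommSemiring R] [Semiring A] [Algebra R A] {s : Set A}
    (hs : ∀ a ∈ s, ∀ b ∈ s, a * b ∈ s) {p q : A} (hp : p ∈ Submodule.span R s) (hq : q ∈ Submodule.span R s) :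
    p * q ∈ Submodule.span R s := by
  have h := Submodule.mul_mem_mul hp hq
  rw [Submodule.span_mul_span] at h
  refine Submodule.span_mono (fun x hx => ?_) h
  obtain ⟨a, ha, b, hb, rfl⟩ := Set.mem_mul.1 hx
  exact hs a ha b hb

/-- The span of the trace-word products is closed under multiplication. [folklore] -/
theorem mul_mem_span_traceWordProducts {ι : Type*} {p q : (ι → G) → ℝ}
    (hp : p ∈ Submodule.span ℝ (traceWordProducts ρ ι)) (hq : q ∈ Submodule.span ℝ (traceWordProducts ρ ι)) :
    p * q ∈ Submodule.span ℝ (traceWordProducts ρ ι) := by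
  refine mul_mem_span_of_mul_closed (fun a ha b hb => ?_) hp hq
  obtain ⟨l₁, rfl⟩ := ha
  obtain ⟨l₂, rfl⟩ := hb
  exact ⟨l₁ ++ l₂, traceWordProduct_append ρ l₁ l₂⟩

/-! ### Words in lassos are loops at the origin -/

variable {d : ℕ}

/-- The lasso of a letter: `lasso e` or its reverse. [folklore] -/
noncomputable def letterLasso (a : ZdEdge d × Bool) : (zdGraph d).Walk (0 : Fin d → ℤ) 0 :=
  if a.2 then lasso a.1 else (lasso a.1).reverse

/-- The loop at the origin spelled by a word in the lassos (concatenation). [cite: Levy2004, Prop 3.6] -/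
noncomputable def wordLasso : List (ZdEdge d × Bool) → (zdGraph d).Walk (0 : Fin d → ℤ) 0
  | [] => SimpleGraph.Walk.nil
  | a :: w => (letterLasso a).append (wordLasso w)

/-- The holonomy of the lasso of a letter is the letter evaluated at the lasso holonomies. [folklore] -/
theorem walkHolonomy_letterLasso (U : LGConfig d G) (a : ZdEdge d × Bool) :
    walkHolonomy U (letterLasso a) = letterVal (lassoConfig U) a := by
  rcases a with ⟨e, _ | _⟩ <;> simp [letterLasso, letterVal, lassoConfig, walkHolonomy_reverse]

/-- **Words in lassos are loops**: `hol_U(wordLasso w) = w(lassoConfig U)`. [cite: Levy2004, Prop 3.6] -/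
theorem walkHolonomy_wordLasso (U : LGConfig d G) :
    ∀ w : List (ZdEdge d × Bool), walkHolonomy U (wordLasso w) = wordVal w (lassoConfig U)
  | [] => by simp [wordLasso]
  | a :: w => by
    simp only [wordLasso, walkHolonomy_append, walkHolonomy_letterLasso, walkHolonomy_wordLasso U w, wordVal_cons]

/-- The list of loops at the origin attached to a list of words in the edges of `S`. [folklore] -/
noncomputable def loopsOfWords (S : Finset (ZdEdge d)) (l : List (List (↥S × Bool) × Bool)) :
    List ((Σ x : (Fin d → ℤ), (zdGraph d).Walk x x) × Bool) :=
  l.map fun p => (⟨0, wordLasso (p.1.map fun a => ((a.1 : ZdEdge d), a.2))⟩, p.2)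

/-- A product of trace words in the variables `e ∈ S`, evaluated at the lasso holonomies, IS a Wilson-loop product of
module XIX. [cite: Levy2004, Prop 3.6] -/
theorem traceWordProduct_lassoConfig (S : Finset (ZdEdge d)) :
    ∀ (l : List (List (↥S × Bool) × Bool)) (U : LGConfig d G),
      traceWordProduct ρ l (fun e : ↥S => lassoConfig U (e : ZdEdge d)) = loopProduct ρ (loopsOfWords S l) U
  | [], U => by simp [loopsOfWords]
  | p :: l, U => by
    have ih := traceWordProduct_lassoConfig S l U
    simp only [loopsOfWords, List.map_cons, traceWordProduct_cons, loopProduct_cons] at ih ⊢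
    rw [loopFactor_eq_tracePart, walkHolonomy_wordLasso, wordVal_map Subtype.val, ← ih]
    rfl

/-- Hence: precomposition with the lasso holonomies maps `traceWordProducts ρ ↥S` into `wilsonLoopProducts ρ d`.
[cite: Levy2004, Prop 3.6] -/
theorem traceWordProduct_lassoConfig_mem (S : Finset (ZdEdge d)) {q : (↥S → G) → ℝ} (hq : q ∈ traceWordProducts ρ ↥S) :
    (fun U : LGConfig d G => q fun e : ↥S => lassoConfig U (e : ZdEdge d)) ∈ wilsonLoopProducts ρ d := by
  obtain ⟨l, rfl⟩ := hq
  exact ⟨loopsOfWords S l, by funext U; exact (traceWordProduct_lassoConfig ρ S l U).symm⟩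

/-- … and therefore the span into the span (precomposition is linear). [folklore] -/
theorem comp_lassoConfig_mem_span (S : Finset (ZdEdge d)) {p : (↥S → G) → ℝ}
    (hp : p ∈ Submodule.span ℝ (traceWordProducts ρ ↥S)) :
    (fun U : LGConfig d G => p fun e : ↥S => lassoConfig U (e : ZdEdge d)) ∈ Submodule.span ℝ (wilsonLoopProducts ρ d) := by
  let Λ : ((↥S → G) → ℝ) →ₗ[ℝ] (LGConfig d G → ℝ) :=
    LinearMap.funLeft ℝ ℝ fun (U : LGConfig d G) (e : ↥S) => lassoConfig U (e : ZdEdge d)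
  have h := Submodule.apply_mem_span_image_of_mem_span Λ hp
  refine Submodule.span_mono ?_ h
  rintro _ ⟨q, hq, rfl⟩
  exact traceWordProduct_lassoConfig_mem ρ S hq

end Words

/-! ## PART C — THE SEVERAL-VARIABLE DENSITY SCHEMA AND THE REDUCTION THEOREM -/

namespace Balaban1983to89.Missing

variable {G : Type*} [Group G] [TopologicalSpace G] {N : ℕ} (ρ : G →* Matrix (Fin N) (Fin N) ℂ)

/-- **`TraceWordsDense ρ` — DENSITY OF TRACE WORDS IN SEVERAL VARIABLES**: for every finite index type `ι`, every
continuous real function of `ι`-many group elements which is invariant under SIMULTANEOUS CONJUGATION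
`(V_i) ↦ (g V_i g⁻¹)` is, for every `ε > 0`, within `ε` in sup norm of a real linear combination of finite products
of the functions `V ↦ Re tr ρ(w(V))`, `V ↦ Im tr ρ(w(V))`, `w` a word in the letters `V_i^{±1}`.  For ONE fixed
representation `ρ` this is the SHAPE of the "natural representation" refinement of Lévy 2004 (abstract; Prop. 5.4)
and of Sengupta 1994 Thm 2 (p.900; `G` a product of abelian groups, `U(n)`, `SU(n)`, `O(n)`, `SO(2n+1)` — no `Sp`,
no even `SO(2n)`; its proof uses only the traces of the positive words in the defining representation: «It is only
this apparently weaker hypothesis that will be used»), i.e. of the first fundamental theorem of invariant theory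
combined with Stone–Weierstrass; Lévy's Prop. 3.4 itself (for `G` a finite product of `U(n), SU(n), O(n), SO(n),
Sp(n)`: if `w(g)` and `w(g')` are conjugate for every word `w`, then `g, g' ∈ G^r` lie in the same diagonal conjugacy
class) is the version with ALL irreducible characters in place of `tr ρ`.  PROVED below for representations whose
character separates points (`traceWordsDense_of_trace_injective`), REFUTED for the real representation `so2Rep` of
`U(1)` (`not_traceWordsDense_so2Rep`), NOT formalised for non-abelian `G`.  A `Prop`-valued schema used as a
HYPOTHESIS; nothing is asserted. [cite: Levy2004, Prop 3.4] -/
def TraceWordsDense : Prop :=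
  ∀ (ι : Type) [Fintype ι] (f : (ι → G) → ℝ), Continuous f →
    (∀ (g : G) (V : ι → G), f (fun i => g * V i * g⁻¹) = f V) →
    ∀ ε : ℝ, 0 < ε → ∃ p ∈ Submodule.span ℝ (traceWordProducts ρ ι), ∀ V, |f V - p V| ≤ ε

/-- **`(W-single)` — THERMODYNAMIC LIMIT OF THE SINGLE WILSON LOOPS**: for every loop `ℓ` of `ℤ^d` the torus
expectations `⟨Re tr ρ(U_ℓ)⟩_{𝕋_{L+1},β}` and `⟨Im tr ρ(U_ℓ)⟩_{𝕋_{L+1},β}` converge as `L → ∞`.  WEAKER than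
`(W-corr)` (`hasWilsonLoopLimits_of_hasWilsonLoopCorrelationLimits`); EQUIVALENT to `(3a)` for one-dimensional
unitary representations with injective character (`hasUniqueInfiniteVolumeLimit_iff_hasWilsonLoopLimits`), in
particular for `U(1)`.  A `Prop`-valued schema; nothing is asserted. [cite: arXiv180301950, §2 p.5] -/
def HasWilsonLoopLimits [CompactSpace G] [IsTopologicalGroup G] [MeasurableSpace G] [BorelSpace G] (d : ℕ) (β : ℝ) :
    Prop :=
  ∀ p : (Σ x : (Fin d → ℤ), (zdGraph d).Walk x x) × Bool, ∃ ℓ : ℝ,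
    Tendsto (fun L : ℕ => wilsonExpectation (L := L + 1) ρ β (toTorusObservable (L + 1) (loopFactor ρ p))) atTop (𝓝 ℓ)

end Balaban1983to89.Missing

open Balaban1983to89.Missing (TraceWordsDense HasWilsonLoopLimits)

section Reduction

variable {d N : ℕ} {G : Type*} [Group G] [TopologicalSpace G] (ρ : G →* Matrix (Fin N) (Fin N) ℂ)

/-- **THE REDUCTION THEOREM (lattice half of Lévy's theorem, PROVED on `ℤ^d` for every group).** If the trace words
are dense in several variables (`TraceWordsDense ρ`), then the real span of the Wilson-loop products in the
representation `ρ` is uniformly dense in the gauge-invariant bounded continuous cylinder observables of `ℤ^d`, in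
every dimension: approximate the slice `cylSlice F S` (continuous, conjugation invariant) by a polynomial `p` in trace
words and precompose with the lasso holonomies — by the LASSO REPRESENTATION `F = cylSlice F S ∘ (hol lasso)|_S`, and
words in lassos are loops. [cite: Levy2004, Thm 3.1 and Props 3.4–3.6] -/
theorem spansGaugeInvariantCylinders_of_traceWordsDense (h : TraceWordsDense ρ) :
    SpansGaugeInvariantCylinders d (wilsonLoopProducts ρ d) := by
  intro F S hFS hFc _ hFg ε hε
  obtain ⟨p, hp, hclose⟩ :=
    h ↥S (cylSlice F S) (continuous_cylSlice hFc S) (fun g V => cylSlice_conj hFg S V g) ε hε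
  refine ⟨fun U => p fun e : ↥S => lassoConfig U (e : ZdEdge d), comp_lassoConfig_mem_span ρ S hp, fun U => ?_⟩
  rw [eq_cylSlice_lasso hFS hFg U]
  exact hclose _

end Reduction

/-! ## PART D — PROOF OF THE SCHEMA WHEN THE CHARACTER SEPARATES POINTS (STONE–WEIERSTRASS) -/

section StoneWeierstrass

variable {N : ℕ} {G : Type*} [Group G] [TopologicalSpace G] (ρ : G →* Matrix (Fin N) (Fin N) ℂ)

/-- `tracePart ρ b` is continuous for continuous `ρ`. [folklore] -/
theorem continuous_tracePart (hρ : Continuous ρ) (b : Bool) : Continuous (tracePart ρ b) := by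
  have htr : Continuous fun g => (ρ g).trace := by
    fun_prop
  cases b
  · exact Complex.continuous_im.comp htr
  · exact Complex.continuous_re.comp htr

/-- The coordinate trace functions `V ↦ Re/Im tr ρ(V_i)` as bundled continuous maps on `ι → G`. [folklore] -/
noncomputable def coordTraceMap (hρ : Continuous ρ) {ι : Type*} (ib : ι × Bool) : C(ι → G, ℝ) :=
  ⟨fun V => tracePart ρ ib.2 (V ib.1), (continuous_tracePart ρ hρ ib.2).comp (continuous_apply ib.1)⟩

/-- The unital real subalgebra of `C(ι → G, ℝ)` generated by the coordinate trace functions. [folklore] -/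
noncomputable def coordTraceAlgebra (hρ : Continuous ρ) (ι : Type*) : Subalgebra ℝ C(ι → G, ℝ) :=
  Algebra.adjoin ℝ (Set.range (coordTraceMap ρ hρ (ι := ι)))

/-- If the character `g ↦ tr ρ(g)` is injective, the coordinate trace functions separate the points of `ι → G`.
[folklore] -/
theorem coordTraceAlgebra_separatesPoints (hρ : Continuous ρ) (hinj : Function.Injective fun g => (ρ g).trace)
    (ι : Type*) : (coordTraceAlgebra ρ hρ ι).SeparatesPoints := by
  intro V V' hne
  obtain ⟨i, hi⟩ := Function.ne_iff.1 hne
  have htr : (ρ (V i)).trace ≠ (ρ (V' i)).trace := fun h => hi (hinj h)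
  by_cases hre : (ρ (V i)).trace.re = (ρ (V' i)).trace.re
  · have him : (ρ (V i)).trace.im ≠ (ρ (V' i)).trace.im := fun him => htr (Complex.ext hre him)
    refine ⟨coordTraceMap ρ hρ (i, false),
      ⟨coordTraceMap ρ hρ (i, false), Algebra.subset_adjoin ⟨(i, false), rfl⟩, rfl⟩, ?_⟩
    simpa [coordTraceMap, tracePart] using him
  · refine ⟨coordTraceMap ρ hρ (i, true),
      ⟨coordTraceMap ρ hρ (i, true), Algebra.subset_adjoin ⟨(i, true), rfl⟩, rfl⟩, ?_⟩
    simpa [coordTraceMap, tracePart] using hre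

/-- Every element of the coordinate trace algebra is, as a function, in the span of the trace-word products
(induction over `Algebra.adjoin`: generators are one-letter trace words, constants are multiples of the empty product,
the span is closed under `+` and `*`). [folklore] -/
theorem coe_mem_span_traceWordProducts (hρ : Continuous ρ) {ι : Type*} {q : C(ι → G, ℝ)}
    (hq : q ∈ coordTraceAlgebra ρ hρ ι) : (q : (ι → G) → ℝ) ∈ Submodule.span ℝ (traceWordProducts ρ ι) := by
  induction hq using Algebra.adjoin_induction with
  | mem x hx =>
    obtain ⟨⟨i, b⟩, rfl⟩ := hx
    exact Submodule.subset_span (tracePart_apply_mem_traceWordProducts ρ i b)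
  | algebraMap r =>
    have h : ((algebraMap ℝ C(ι → G, ℝ) r : C(ι → G, ℝ)) : (ι → G) → ℝ) = r • traceWordProduct (ι := ι) ρ [] := by
      funext V
      simp [Algebra.algebraMap_eq_smul_one]
    rw [h]
    exact Submodule.smul_mem _ r (Submodule.subset_span ⟨[], rfl⟩)
  | add x y _ _ hx hy =>
    rw [ContinuousMap.coe_add]
    exact Submodule.add_mem _ hx hy
  | mul x y _ _ hx hy =>
    rw [ContinuousMap.coe_mul]
    exact mul_mem_span_traceWordProducts ρ hx hy

/-- **THE SCHEMA HOLDS WHEN THE CHARACTER SEPARATES POINTS.** For compact `G` and continuous `ρ` with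
`g ↦ tr ρ(g)` injective, `TraceWordsDense ρ` holds — indeed EVERY continuous `f : (ι → G) → ℝ` (conjugation invariant
or not) is uniformly approximable by polynomials in `Re/Im tr ρ(V_i)`: real Stone–Weierstrass on the compact space
`ι → G` (Mathlib `ContinuousMap.exists_mem_subalgebra_near_continuous_of_separatesPoints`).  Covers `G = U(1)` with
`ρ = u1Rep` and every compact abelian group with a faithful one-dimensional representation (Lévy 2004 Example 3.2:
for one edge this is the density of trigonometric polynomials). [cite: Levy2004, Thm 3.1 and Example 3.2] -/
theorem traceWordsDense_of_trace_injective [CompactSpace G] (hρ : Continuous ρ)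
    (hinj : Function.Injective fun g => (ρ g).trace) : TraceWordsDense ρ := by
  intro ι _ f hf _ ε hε
  obtain ⟨g, hg⟩ := ContinuousMap.exists_mem_subalgebra_near_continuous_of_separatesPoints
    (coordTraceAlgebra ρ hρ ι) (coordTraceAlgebra_separatesPoints ρ hρ hinj ι) f hf ε hε
  refine ⟨(g : C(ι → G, ℝ)), coe_mem_span_traceWordProducts ρ hρ g.2, fun V => ?_⟩
  have h := hg V
  rw [Real.norm_eq_abs, abs_sub_comm] at h
  exact h.le

/-- Hence Lévy's density on `ℤ^d` for such `ρ`, in every dimension. [cite: Levy2004, Thm 3.1] -/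
theorem spansGaugeInvariantCylinders_of_trace_injective [CompactSpace G] {d : ℕ} (hρ : Continuous ρ)
    (hinj : Function.Injective fun g => (ρ g).trace) : SpansGaugeInvariantCylinders d (wilsonLoopProducts ρ d) :=
  spansGaugeInvariantCylinders_of_traceWordsDense ρ (traceWordsDense_of_trace_injective ρ hρ hinj)

end StoneWeierstrass

/-! ## PART E — `(3a) ⟺ (W-corr)` UNCONDITIONALLY FOR TRACE-SEPARATING `ρ`; THE CASE `U(1)` -/

section Headline

variable {d N : ℕ} {G : Type*} [Group G] [TopologicalSpace G] [IsTopologicalGroup G] [CompactSpace G]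
  [MeasurableSpace G] [BorelSpace G] [SecondCountableTopology G] [T2Space G] (ρ : G →* Matrix (Fin N) (Fin N) ℂ)

/-- **HEADLINE — `(3a) ⟺ (W-corr)` WITHOUT A DENSITY HYPOTHESIS, for every continuous representation whose character
separates points** (every `d`, every real `β`): the torus Wilson states of the `ℤ^d` lattice gauge theory have a
unique infinite-volume limit iff every Wilson-loop correlation `⟨∏ᵢ Re/Im tr ρ(U_{ℓᵢ})⟩_{𝕋_{L+1},β}` converges as
`L → ∞`.  Module XIX's `hasUniqueInfiniteVolumeLimit_iff_hasWilsonLoopCorrelationLimits` with its hypothesis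
DISCHARGED by `spansGaugeInvariantCylinders_of_trace_injective`. [cite: Levy2004, Thm 3.1] -/
theorem hasUniqueInfiniteVolumeLimit_iff_hasWilsonLoopCorrelationLimits_of_trace_injective (hρ : Continuous ρ)
    (hinj : Function.Injective fun g => (ρ g).trace) (β : ℝ) :
    HasUniqueInfiniteVolumeLimit (d := d) ρ β ↔ HasWilsonLoopCorrelationLimits ρ d β :=
  hasUniqueInfiniteVolumeLimit_iff_hasWilsonLoopCorrelationLimits ρ hρ β
    (spansGaugeInvariantCylinders_of_trace_injective ρ hρ hinj)

end Headline

section U1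

/-- The character of the defining representation of `U(1)` is the inclusion `Circle → ℂ`. [folklore] -/
@[simp] theorem trace_u1Rep (z : Circle) : (u1Rep z).trace = (z : ℂ) := by
  simp [u1Rep_apply, Matrix.scalar_apply, Matrix.trace_diagonal]

/-- The character of `u1Rep` separates points. [folklore] -/
theorem u1Rep_trace_injective : Function.Injective fun z : Circle => (u1Rep z).trace := fun z w h => by
  apply Circle.ext
  simpa using h

variable {d : ℕ}

/-- **`U(1)`: Lévy's density on `ℤ^d` holds for the defining representation** (every `d`). [cite: Levy2004, Thm 3.1] -/
theorem spansGaugeInvariantCylinders_u1 : SpansGaugeInvariantCylinders d (wilsonLoopProducts u1Rep d) :=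
  spansGaugeInvariantCylinders_of_trace_injective u1Rep continuous_u1Rep u1Rep_trace_injective

variable [MeasurableSpace Circle] [BorelSpace Circle]

/-- **`U(1)`, HEADLINE: `(3a) ⟺ (W-corr)` unconditionally** — for compact `U(1)` lattice gauge theory (Wilson action,
periodic boundary conditions) in every dimension `d` and at every real `β`, the torus states have a unique
infinite-volume limit iff every correlation of Wilson loops `⟨∏ᵢ Re/Im U(ℓᵢ)⟩_{𝕋_{L+1},β}` converges as `L → ∞`.
(`Circle` carries its Borel σ-algebra as instance arguments, as in the tree's `HeatKernelGroup`.) [cite: Levy2004, Thm 3.1] -/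
theorem hasUniqueInfiniteVolumeLimit_iff_hasWilsonLoopCorrelationLimits_u1 (β : ℝ) :
    HasUniqueInfiniteVolumeLimit (d := d) u1Rep β ↔ HasWilsonLoopCorrelationLimits u1Rep d β :=
  hasUniqueInfiniteVolumeLimit_iff_hasWilsonLoopCorrelationLimits_of_trace_injective u1Rep continuous_u1Rep
    u1Rep_trace_injective β

end U1

/-! ## PART F — ONE-DIMENSIONAL UNITARY `ρ`: SINGLE LOOPS SUFFICE -/

section SingleLoops

variable {d : ℕ} {G : Type*} [Group G]

/-- TRANSPORT OF THE BASE POINT: conjugating a loop `ℓ` at `y` by a walk `γ : x ⤳ y` gives a loop at `x` with the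
same trace in every representation (cyclicity). [folklore] -/
theorem loopFactor_transport {N : ℕ} (ρ : G →* Matrix (Fin N) (Fin N) ℂ) {x y : Fin d → ℤ} (γ : (zdGraph d).Walk x y)
    (ℓ : (zdGraph d).Walk y y) (b : Bool) (U : LGConfig d G) :
    loopFactor ρ (⟨x, γ.append (ℓ.append γ.reverse)⟩, b) U = loopFactor ρ (⟨y, ℓ⟩, b) U := by
  rw [loopFactor_eq_tracePart, loopFactor_eq_tracePart]
  simp only [walkHolonomy_append, walkHolonomy_reverse, ← mul_assoc]
  exact tracePart_conj ρ b _ _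

variable (ρ : G →* Matrix (Fin 1) (Fin 1) ℂ)

/-- For `N = 1` the character is the single matrix entry, a MULTIPLICATIVE map `G →* ℂ`. [folklore] -/
def entryHom : G →* ℂ where
  toFun g := ρ g 0 0
  map_one' := by simp
  map_mul' g h := by
    rw [map_mul, Matrix.mul_apply, Fin.sum_univ_one]

/-- `tr ρ(g) = ρ(g)₀₀` for `N = 1`. [folklore] -/
theorem trace_eq_entryHom (g : G) : (ρ g).trace = entryHom ρ g := by
  rw [Matrix.trace_fin_one]
  rfl

/-- For unitary one-dimensional `ρ`, `tr ρ(g⁻¹) = conj (tr ρ(g))`. [folklore] -/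
theorem entryHom_inv_eq_conj (hunit : ∀ g, ρ g ∈ Matrix.unitaryGroup (Fin 1) ℂ) (g : G) :
    entryHom ρ g⁻¹ = starRingEnd ℂ (entryHom ρ g) := by
  have h1 : starRingEnd ℂ (entryHom ρ g) * entryHom ρ g = 1 := by
    have hu := Matrix.mem_unitaryGroup_iff'.1 (hunit g)
    have := congrArg (fun M : Matrix (Fin 1) (Fin 1) ℂ => M 0 0) hu
    simpa [Matrix.mul_apply, Matrix.star_apply, entryHom] using this
  have h2 : entryHom ρ g⁻¹ * entryHom ρ g = 1 := by rw [← map_mul, inv_mul_cancel, map_one]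
  have hne : entryHom ρ g ≠ 0 := fun h0 => by simp [h0] at h2
  exact mul_right_cancel₀ hne (h2.trans h1.symm)

/-- `2 Re a Re b = Re(ab) + Re(a b̄)`, `2 Im a Im b = Re(a b̄) - Re(ab)`, `2 Re a Im b = Im(ab) - Im(a b̄)`,
`2 Im a Re b = Im(ab) + Im(a b̄)`: the product of two `tracePart`s of a one-dimensional unitary `ρ` is a combination
of `tracePart`s of the products `g h` and `g h⁻¹`. [folklore] -/
theorem tracePart_mul_tracePart (hunit : ∀ g, ρ g ∈ Matrix.unitaryGroup (Fin 1) ℂ) (b₁ b₂ : Bool) :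
    ∃ c₁ c₂ : ℝ, ∃ b : Bool, ∀ g h : G, tracePart ρ b₁ g * tracePart ρ b₂ h =
      c₁ * tracePart ρ b (g * h) + c₂ * tracePart ρ b (g * h⁻¹) := by
  have hmul : ∀ g h : G, (ρ (g * h)).trace = (ρ g).trace * (ρ h).trace := fun g h => by
    rw [trace_eq_entryHom, trace_eq_entryHom, trace_eq_entryHom, map_mul]
  have hconj : ∀ h : G, (ρ h⁻¹).trace = starRingEnd ℂ ((ρ h).trace) := fun h => by
    rw [trace_eq_entryHom, trace_eq_entryHom, entryHom_inv_eq_conj ρ hunit]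
  cases b₁ <;> cases b₂
  · -- Im · Im
    refine ⟨-(1/2), 1/2, true, fun g h => ?_⟩
    simp only [tracePart, hmul, hconj, Complex.mul_re, Complex.conj_re, Complex.conj_im]
    ring
  · -- Im · Re
    refine ⟨1/2, 1/2, false, fun g h => ?_⟩
    simp only [tracePart, hmul, hconj, Complex.mul_im, Complex.conj_re, Complex.conj_im]
    ring
  · -- Re · Im
    refine ⟨1/2, -(1/2), false, fun g h => ?_⟩
    simp only [tracePart, hmul, hconj, Complex.mul_im, Complex.conj_re, Complex.conj_im]
    ring
  · -- Re · Re
    refine ⟨1/2, 1/2, true, fun g h => ?_⟩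
    simp only [tracePart, hmul, hconj, Complex.mul_re, Complex.conj_re, Complex.conj_im]
    ring

/-- **The product of two Wilson-loop generators of a one-dimensional unitary `ρ` is a combination of two single
generators** (transport the second loop to the base point of the first, concatenate with `ℓ₂^{±1}`).
[folklore] -/
theorem loopFactor_mul_loopFactor_mem_span (hunit : ∀ g, ρ g ∈ Matrix.unitaryGroup (Fin 1) ℂ)
    (p₁ p₂ : (Σ x : (Fin d → ℤ), (zdGraph d).Walk x x) × Bool) :
    loopFactor ρ p₁ * loopFactor ρ p₂ ∈ Submodule.span ℝ (Set.range (loopFactor (d := d) ρ)) := by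
  obtain ⟨⟨x₁, ℓ₁⟩, b₁⟩ := p₁
  obtain ⟨⟨x₂, ℓ₂⟩, b₂⟩ := p₂
  obtain ⟨c₁, c₂, b, hb⟩ := tracePart_mul_tracePart ρ hunit b₁ b₂
  let γ : (zdGraph d).Walk x₁ x₂ := (zdGraph_reachable x₁ x₂).some
  let Lp : (zdGraph d).Walk x₁ x₁ := ℓ₁.append (γ.append (ℓ₂.append γ.reverse))
  let Lm : (zdGraph d).Walk x₁ x₁ := ℓ₁.append (γ.append (ℓ₂.reverse.append γ.reverse))
  have key : loopFactor ρ (⟨x₁, ℓ₁⟩, b₁) * loopFactor ρ (⟨x₂, ℓ₂⟩, b₂) =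
      c₁ • loopFactor ρ (⟨x₁, Lp⟩, b) + c₂ • loopFactor ρ (⟨x₁, Lm⟩, b) := by
    funext U
    have h2 : tracePart ρ b₂ (walkHolonomy U ℓ₂) =
        tracePart ρ b₂ (walkHolonomy U γ * walkHolonomy U ℓ₂ * (walkHolonomy U γ)⁻¹) := (tracePart_conj ρ b₂ _ _).symm
    simp only [Pi.mul_apply, Pi.add_apply, Pi.smul_apply, smul_eq_mul, loopFactor_eq_tracePart, Lp, Lm,
      walkHolonomy_append, walkHolonomy_reverse]
    rw [h2, hb _ _]
    congr 2
    · simp only [mul_assoc]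
    · simp only [mul_inv_rev, inv_inv, mul_assoc]
  rw [key]
  exact Submodule.add_mem _ (Submodule.smul_mem _ _ (Submodule.subset_span ⟨_, rfl⟩))
    (Submodule.smul_mem _ _ (Submodule.subset_span ⟨_, rfl⟩))

/-- The constant `1` is the generator of the trivial loop (`Re tr ρ(1) = 1` for `N = 1`). [folklore] -/
theorem loopFactor_nil_true (x : Fin d → ℤ) :
    loopFactor ρ (⟨x, (SimpleGraph.Walk.nil : (zdGraph d).Walk x x)⟩, true) = fun _ => (1 : ℝ) := by
  funext U
  rw [loopFactor_eq_tracePart]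
  simp [tracePart]

/-- **For one-dimensional unitary `ρ` the span of the Wilson-loop PRODUCTS is the span of the SINGLE Wilson loops.**
[folklore] -/
theorem span_wilsonLoopProducts_le_span_loopFactor (hunit : ∀ g, ρ g ∈ Matrix.unitaryGroup (Fin 1) ℂ) :
    Submodule.span ℝ (wilsonLoopProducts ρ d) ≤ Submodule.span ℝ (Set.range (loopFactor (d := d) ρ)) := by
  refine Submodule.span_le.2 ?_
  rintro _ ⟨l, rfl⟩
  induction l with
  | nil =>
    rw [loopProduct_nil, ← loopFactor_nil_true ρ (0 : Fin d → ℤ)]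
    exact Submodule.subset_span ⟨_, rfl⟩
  | cons p l ih =>
    rw [loopProduct_cons]
    change loopFactor ρ p * loopProduct ρ l ∈ _
    refine Submodule.span_induction (p := fun q _ => loopFactor ρ p * q ∈ Submodule.span ℝ (Set.range (loopFactor ρ)))
      ?_ ?_ ?_ ?_ ih
    · rintro _ ⟨p', rfl⟩
      exact loopFactor_mul_loopFactor_mem_span ρ hunit p p'
    · simp
    · intro q₁ q₂ _ _ h₁ h₂
      rw [mul_add]
      exact Submodule.add_mem _ h₁ h₂
    · intro c q _ hq
      rw [mul_smul_comm]
      exact Submodule.smul_mem _ c hq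

variable [TopologicalSpace G]

/-- Hence, for one-dimensional unitary `ρ` with injective character, the SINGLE Wilson loops already span a dense
subspace of the gauge-invariant continuous cylinders. [cite: Levy2004, Thm 3.1 and Example 3.2] -/
theorem spansGaugeInvariantCylinders_loopFactor [CompactSpace G] (hρ : Continuous ρ)
    (hinj : Function.Injective fun g => (ρ g).trace) (hunit : ∀ g, ρ g ∈ Matrix.unitaryGroup (Fin 1) ℂ) :
    SpansGaugeInvariantCylinders d (Set.range (loopFactor (d := d) ρ)) := by
  intro F S hFS hFc hFb hFg ε hε
  obtain ⟨W, hW, hclose⟩ := spansGaugeInvariantCylinders_of_trace_injective ρ hρ hinj F S hFS hFc hFb hFg ε hε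
  exact ⟨W, span_wilsonLoopProducts_le_span_loopFactor ρ hunit hW, hclose⟩

variable [IsTopologicalGroup G] [CompactSpace G] [MeasurableSpace G] [BorelSpace G]

/-- `(W-corr) ⟹ (W-single)` (a single loop is a one-factor correlation), for every `ρ`. [folklore] -/
theorem hasWilsonLoopLimits_of_hasWilsonLoopCorrelationLimits {N : ℕ} (ρ' : G →* Matrix (Fin N) (Fin N) ℂ) {β : ℝ}
    (h : HasWilsonLoopCorrelationLimits ρ' d β) : HasWilsonLoopLimits ρ' d β := fun p => by
  have hp : loopProduct ρ' [p] = loopFactor ρ' p := by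
    funext U; simp [loopProduct]
  simpa [hp] using h [p]

variable [SecondCountableTopology G] [T2Space G]

/-- `(3a) ⟹ (W-single)` for EVERY continuous representation `ρ'` (every `d`, `β`): module XIX's necessity half
followed by `(W-corr) ⟹ (W-single)`.  The converse is proved below only for `N = 1`; for `N ≥ 2` it is NOT claimed
(whether single-loop expectations determine a gauge-invariant state is a separate question).
[cite: arXiv180301950, §2 p.5] -/
theorem hasWilsonLoopLimits_of_hasUniqueInfiniteVolumeLimit {N : ℕ} (ρ' : G →* Matrix (Fin N) (Fin N) ℂ)
    (hρ' : Continuous ρ') (β : ℝ) (h : HasUniqueInfiniteVolumeLimit (d := d) ρ' β) : HasWilsonLoopLimits ρ' d β :=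
  hasWilsonLoopLimits_of_hasWilsonLoopCorrelationLimits ρ'
    (hasWilsonLoopCorrelationLimits_of_hasUniqueInfiniteVolumeLimit ρ' hρ' β h)

/-- **`(3a) ⟺ (W-single)` for one-dimensional unitary `ρ` with injective character** (every `d`, every real `β`):
uniqueness of the infinite-volume limit of the torus states is equivalent to the convergence, for every single loop
`ℓ`, of `⟨Re tr ρ(U_ℓ)⟩_{𝕋_{L+1},β}` and `⟨Im tr ρ(U_ℓ)⟩_{𝕋_{L+1},β}` as `L → ∞`.
[cite: Levy2004, Thm 3.1 and Example 3.2] -/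
theorem hasUniqueInfiniteVolumeLimit_iff_hasWilsonLoopLimits (hρ : Continuous ρ)
    (hinj : Function.Injective fun g => (ρ g).trace) (hunit : ∀ g, ρ g ∈ Matrix.unitaryGroup (Fin 1) ℂ) (β : ℝ) :
    HasUniqueInfiniteVolumeLimit (d := d) ρ β ↔ HasWilsonLoopLimits ρ d β := by
  have h𝒲 : ∀ W ∈ Set.range (loopFactor (d := d) ρ), IsLocalObservable W ∧ Measurable W ∧ ∃ C, ∀ U, |W U| ≤ C := by
    rintro W ⟨p, rfl⟩
    exact ⟨isLocalObservable_loopFactor ρ p, (continuous_loopFactor ρ hρ p).measurable, exists_abs_loopFactor_le ρ hρ p⟩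
  rw [hasUniqueInfiniteVolumeLimit_iff_tendsto_of_spans ρ hρ β h𝒲 (spansGaugeInvariantCylinders_loopFactor ρ hρ hinj hunit)]
  simp only [HasWilsonLoopLimits, Set.forall_mem_range]

end SingleLoops

section U1Single

variable {d : ℕ} [MeasurableSpace Circle] [BorelSpace Circle]

/-- **`U(1)`, SHARPEST FORM: `(3a) ⟺ (W-single)`** — compact `U(1)` lattice gauge theory in dimension `d` at real
coupling `β` has a unique infinite-volume limit of its torus states iff for every lattice loop `ℓ` the torus
expectations `⟨Re U(ℓ)⟩_{𝕋_{L+1},β} = ⟨cos θ(ℓ)⟩` and `⟨Im U(ℓ)⟩_{𝕋_{L+1},β} = ⟨sin θ(ℓ)⟩` converge as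
`L → ∞`;
equivalently (XIX `hasWilsonLoopCorrelationLimits_iff_cauchySeq` pattern) iff each is CAUCHY in the torus size.  THE
EXACT MISSING ESTIMATE in the abelian case. [cite: Levy2004, Thm 3.1 and Example 3.2] -/
theorem hasUniqueInfiniteVolumeLimit_iff_hasWilsonLoopLimits_u1 (β : ℝ) :
    HasUniqueInfiniteVolumeLimit (d := d) u1Rep β ↔ HasWilsonLoopLimits u1Rep d β :=
  hasUniqueInfiniteVolumeLimit_iff_hasWilsonLoopLimits u1Rep continuous_u1Rep u1Rep_trace_injective
    u1Rep_mem_unitaryGroup β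

/-- … and in Cauchy form: `(3a)` iff for every loop `ℓ` and `b ∈ {Re, Im}` the real sequence
`L ↦ ⟨b U(ℓ)⟩_{𝕋_{L+1},β}` is Cauchy. [folklore] -/
theorem hasUniqueInfiniteVolumeLimit_u1_iff_cauchySeq (β : ℝ) :
    HasUniqueInfiniteVolumeLimit (d := d) u1Rep β ↔
      ∀ p : (Σ x : (Fin d → ℤ), (zdGraph d).Walk x x) × Bool,
        CauchySeq fun L : ℕ => wilsonExpectation (L := L + 1) u1Rep β (toTorusObservable (L + 1) (loopFactor u1Rep p)) := by
  rw [hasUniqueInfiniteVolumeLimit_iff_hasWilsonLoopLimits_u1]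
  exact forall_congr' fun _ => ⟨fun ⟨_, h⟩ => h.cauchySeq, fun h => cauchySeq_tendsto_of_complete h⟩

end U1Single

/-! ## PART G — CENSUS NEGATIVES: THE DENSITY SCHEMA IS NOT AUTOMATIC, AND FAITHFULNESS IS NOT THE RIGHT HYPOTHESIS -/

section Negatives

variable {d : ℕ}

/-- The imaginary unit as an element of `U(1) = Circle`. [folklore] -/
noncomputable def circleI : Circle := ⟨Complex.I, by simp [Submonoid.unitSphere]⟩

/-- `(circleI : ℂ) = I`. [folklore] -/
@[simp] theorem coe_circleI : ((circleI : Circle) : ℂ) = Complex.I := rfl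

/-- The test configuration: `I` on the edge `(0, 0)`, `1` elsewhere. [folklore] -/
noncomputable def testConfig (d : ℕ) : LGConfig (d + 2) Circle := fun e =>
  if e = ((0 : Fin (d + 2) → ℤ), (0 : Fin (d + 2))) then circleI else 1

/-- The test observable: the imaginary part of the plaquette holonomy at the origin in the `(0,1)` plane
(`sin` of the plaquette angle). [folklore] -/
noncomputable def imPlaquette (d : ℕ) (U : LGConfig (d + 2) Circle) : ℝ :=
  ((plaquetteHolonomyZd U 0 0 1 : Circle) : ℂ).im

/-- `imPlaquette` is gauge invariant (abelian group: the plaquette holonomy is exactly invariant). [folklore] -/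
theorem isZdGaugeInvariant_imPlaquette : IsZdGaugeInvariant (imPlaquette d) := by
  intro g U
  simp only [imPlaquette, plaquetteHolonomyZd_gaugeTransformZd, mul_inv_cancel_comm]

/-- `imPlaquette` is a cylinder on the four plaquette edges. [folklore] -/
theorem isCylinder_imPlaquette :
    IsCylinder (imPlaquette d) {((0 : Fin (d + 2) → ℤ), (0 : Fin (d + 2))), ((0 : Fin (d + 2) → ℤ) + Pi.single 0 1, 1),
      ((0 : Fin (d + 2) → ℤ) + Pi.single 1 1, 0), ((0 : Fin (d + 2) → ℤ), 1)} := by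
  intro U V h
  simp only [imPlaquette, plaquetteHolonomyZd]
  rw [h _ (by simp), h ((0 : Fin (d + 2) → ℤ) + Pi.single 0 1, 1) (by simp),
    h ((0 : Fin (d + 2) → ℤ) + Pi.single 1 1, 0) (by simp), h ((0 : Fin (d + 2) → ℤ), 1) (by simp)]

/-- `imPlaquette` is continuous. [folklore] -/
theorem continuous_imPlaquette : Continuous (imPlaquette d) := by
  unfold imPlaquette plaquetteHolonomyZd
  fun_prop

/-- `|imPlaquette U| ≤ 1`. [folklore] -/
theorem abs_imPlaquette_le (U : LGConfig (d + 2) Circle) : |imPlaquette d U| ≤ 1 := by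
  unfold imPlaquette
  exact (Complex.abs_im_le_norm _).trans (Circle.norm_coe _).le

/-- The plaquette holonomy of the test configuration is `I`. [folklore] -/
theorem plaquetteHolonomyZd_testConfig : plaquetteHolonomyZd (testConfig d) 0 0 1 = circleI := by
  have h1 : testConfig d ((0 : Fin (d + 2) → ℤ), 0) = circleI := by simp [testConfig]
  have h2 : testConfig d ((0 : Fin (d + 2) → ℤ) + Pi.single 0 1, 1) = 1 := by simp [testConfig]
  have h3 : testConfig d ((0 : Fin (d + 2) → ℤ) + Pi.single 1 1, 0) = 1 := by simp [testConfig]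
  have h4 : testConfig d ((0 : Fin (d + 2) → ℤ), 1) = 1 := by simp [testConfig]
  rw [plaquetteHolonomyZd, h1, h2, h3, h4, inv_one, mul_one, mul_one, mul_one]

/-- `imPlaquette (testConfig) = 1`. [folklore] -/
theorem imPlaquette_testConfig : imPlaquette d (testConfig d) = 1 := by
  simp [imPlaquette, plaquetteHolonomyZd_testConfig]

/-- In an ABELIAN group the plaquette holonomy of the inverted configuration is the inverse. [folklore] -/
theorem plaquetteHolonomyZd_inv_comm {G : Type*} [CommGroup G] (U : LGConfig d G) (x : Fin d → ℤ) (i j : Fin d) :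
    plaquetteHolonomyZd U⁻¹ x i j = (plaquetteHolonomyZd U x i j)⁻¹ := by
  simp only [plaquetteHolonomyZd, Pi.inv_apply, mul_inv]

/-- `imPlaquette (testConfig⁻¹) = -1`. [folklore] -/
theorem imPlaquette_testConfig_inv : imPlaquette d (testConfig d)⁻¹ = -1 := by
  rw [imPlaquette, plaquetteHolonomyZd_inv_comm, plaquetteHolonomyZd_testConfig, Circle.coe_inv_eq_conj, coe_circleI]
  simp

/-- `imPlaquette 1 = 0`. [folklore] -/
theorem imPlaquette_one : imPlaquette d 1 = 0 := by
  simp [imPlaquette, plaquetteHolonomyZd]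

/-! ### (i) The trivial representation: the schema fails -/

/-- For the TRIVIAL representation every Wilson-loop generator is constant … [folklore] -/
theorem loopFactor_one_const {G : Type*} [Group G] {N : ℕ} (p : (Σ x : (Fin d → ℤ), (zdGraph d).Walk x x) × Bool)
    (U V : LGConfig d G) :
    loopFactor (1 : G →* Matrix (Fin N) (Fin N) ℂ) p U = loopFactor (1 : G →* Matrix (Fin N) (Fin N) ℂ) p V := by
  rcases p with ⟨ℓ, b⟩
  rw [loopFactor_eq_tracePart, loopFactor_eq_tracePart]
  cases b <;> simp [tracePart]

/-- … hence every element of the span of the Wilson-loop products is a constant function. [folklore] -/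
theorem const_of_mem_span_wilsonLoopProducts_one {G : Type*} [Group G] {N : ℕ} {W : LGConfig d G → ℝ}
    (hW : W ∈ Submodule.span ℝ (wilsonLoopProducts (1 : G →* Matrix (Fin N) (Fin N) ℂ) d)) (U V : LGConfig d G) :
    W U = W V := by
  induction hW using Submodule.span_induction with
  | mem w hw =>
    obtain ⟨l, rfl⟩ := hw
    induction l with
    | nil => simp
    | cons p l ih => simp only [loopProduct_cons, loopFactor_one_const p U V, ih]
  | zero => rfl
  | add w₁ w₂ _ _ h₁ h₂ => simp [h₁, h₂]
  | smul c w _ h => simp [h]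

/-- **NEGATIVE (i): the density schema FAILS for the trivial representation of `U(1)`** (`d ≥ 2`): `Im U_p` is a
gauge-invariant continuous bounded cylinder taking the values `0` and `1`, so it is not within `1/4` of any constant.
The schema `SpansGaugeInvariantCylinders` therefore has content (it is not a tautology of the definitions). [folklore] -/
theorem not_spansGaugeInvariantCylinders_trivial :
    ¬ SpansGaugeInvariantCylinders (d + 2) (wilsonLoopProducts (1 : Circle →* Matrix (Fin 1) (Fin 1) ℂ) (d + 2)) := by
  intro h
  obtain ⟨W, hW, hclose⟩ := h (imPlaquette d) _ isCylinder_imPlaquette continuous_imPlaquette ⟨1, abs_imPlaquette_le⟩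
    isZdGaugeInvariant_imPlaquette (1/4) (by norm_num)
  have h1 := hclose (testConfig d)
  have h0 := hclose 1
  rw [imPlaquette_testConfig] at h1
  rw [imPlaquette_one, const_of_mem_span_wilsonLoopProducts_one hW 1 (testConfig d)] at h0
  obtain ⟨h1a, h1b⟩ := abs_le.1 h1
  obtain ⟨h0a, h0b⟩ := abs_le.1 h0
  linarith

/-! ### (ii) The faithful real representation of `U(1)`: the schema fails although `ρ` is injective -/

/-- The REAL two-dimensional representation of `U(1)`: `z = a + ib ↦ [[a, -b], [b, a]]` (the natural representation
of `SO(2) ≅ U(1)`), as complex `2 × 2` matrices.  Faithful, continuous, with character `2 Re z`. [folklore] -/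
noncomputable def so2Rep : Circle →* Matrix (Fin 2) (Fin 2) ℂ where
  toFun z := !![((z : ℂ).re : ℂ), -((z : ℂ).im : ℂ); ((z : ℂ).im : ℂ), ((z : ℂ).re : ℂ)]
  map_one' := by
    ext i j
    fin_cases i <;> fin_cases j <;> simp
  map_mul' z w := by
    ext i j
    fin_cases i <;> fin_cases j <;>
      simp [Matrix.mul_apply, Fin.sum_univ_two, Complex.mul_re, Complex.mul_im] <;> ring

/-- `so2Rep z = [[Re z, -Im z], [Im z, Re z]]`. [folklore] -/
theorem so2Rep_apply (z : Circle) :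
    so2Rep z = !![((z : ℂ).re : ℂ), -((z : ℂ).im : ℂ); ((z : ℂ).im : ℂ), ((z : ℂ).re : ℂ)] := rfl

/-- `so2Rep` is FAITHFUL. [folklore] -/
theorem so2Rep_injective : Function.Injective so2Rep := fun z w h => by
  have hre := congrArg (fun M : Matrix (Fin 2) (Fin 2) ℂ => M 0 0) h
  have him := congrArg (fun M : Matrix (Fin 2) (Fin 2) ℂ => M 1 0) h
  simp only [so2Rep_apply, Matrix.of_apply, Matrix.cons_val', Matrix.cons_val_zero, Matrix.cons_val_one,
    Matrix.empty_val', Matrix.cons_val_fin_one, Complex.ofReal_inj] at hre him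
  exact Circle.ext (Complex.ext hre him)

/-- The character of `so2Rep` is `2 Re z` … [folklore] -/
@[simp] theorem trace_so2Rep (z : Circle) : (so2Rep z).trace = 2 * ((z : ℂ).re : ℂ) := by
  rw [so2Rep_apply, Matrix.trace_fin_two_of]
  ring

/-- … so it does NOT separate points (`z` and `z̄ = z⁻¹` have the same trace), … [folklore] -/
theorem trace_so2Rep_inv (z : Circle) : (so2Rep z⁻¹).trace = (so2Rep z).trace := by
  rw [trace_so2Rep, trace_so2Rep, Circle.coe_inv_eq_conj, Complex.conj_re]

/-- … its real part is even under inversion and its imaginary part vanishes. [folklore] -/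
theorem tracePart_so2Rep_inv (b : Bool) (z : Circle) : tracePart so2Rep b z⁻¹ = tracePart so2Rep b z := by
  cases b <;> simp [tracePart]

/-- In an ABELIAN group the holonomy of the inverted configuration is the inverse holonomy. [folklore] -/
theorem walkHolonomy_inv {G : Type*} [CommGroup G] {x y : Fin d → ℤ} (U : LGConfig d G) (w : (zdGraph d).Walk x y) :
    walkHolonomy U⁻¹ w = (walkHolonomy U w)⁻¹ := by
  have hd : ∀ e, dartHolonomy U⁻¹ e = (dartHolonomy U e)⁻¹ := fun e => by
    unfold dartHolonomy; split <;> simp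
  simp only [walkHolonomy, List.prod_inv, List.map_map]
  exact congrArg List.prod (List.map_congr_left fun e _ => hd e)

/-- Every Wilson-loop generator of `so2Rep` is INVARIANT UNDER THE GLOBAL INVERSION `U ↦ U⁻¹`. [folklore] -/
theorem loopFactor_so2Rep_inv (p : (Σ x : (Fin d → ℤ), (zdGraph d).Walk x x) × Bool) (U : LGConfig d Circle) :
    loopFactor so2Rep p U⁻¹ = loopFactor so2Rep p U := by
  rcases p with ⟨ℓ, b⟩
  rw [loopFactor_eq_tracePart, loopFactor_eq_tracePart, walkHolonomy_inv, tracePart_so2Rep_inv]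

/-- … hence so is every element of the span of the Wilson-loop products of `so2Rep`. [folklore] -/
theorem mem_span_wilsonLoopProducts_so2Rep_inv {W : LGConfig d Circle → ℝ}
    (hW : W ∈ Submodule.span ℝ (wilsonLoopProducts so2Rep d)) (U : LGConfig d Circle) : W U⁻¹ = W U := by
  induction hW using Submodule.span_induction with
  | mem w hw =>
    obtain ⟨l, rfl⟩ := hw
    induction l with
    | nil => simp
    | cons p l ih => simp only [loopProduct_cons, loopFactor_so2Rep_inv, ih]
  | zero => rfl
  | add w₁ w₂ _ _ h₁ h₂ => simp [h₁, h₂]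
  | smul c w _ h => simp [h]

/-- **NEGATIVE (ii): the density schema FAILS for the FAITHFUL representation `so2Rep` of `U(1)`** (`d ≥ 2`): every
element `W` of the span of its Wilson-loop products satisfies `W(U⁻¹) = W(U)`, while the gauge-invariant cylinder
`Im U_p` takes the values `1` at the test configuration and `-1` at its inverse — so it is not within `1/2` of the
span.  Faithfulness of `ρ` is therefore NOT sufficient for Lévy's density in the representation `ρ`: for the
natural (rotation) representation of the SPECIAL orthogonal group `SO(2) ≅ U(1)` the Wilson loops are NOT enough,
whereas Lévy 2004 (abstract; Prop. 5.4) has "natural representation enough" for orthogonal `O(n)` — under the full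
`O(2)` the inversion `U ↦ U⁻¹` is a constant gauge transformation (conjugation by a reflection), so there is no
conflict — and Sengupta 1994 Thm 2 (p.900) lists `O(n)` and, among the special orthogonal groups, `SO(2n+1)` only.
[cite: Levy2004, §5] -/
theorem not_spansGaugeInvariantCylinders_so2Rep :
    ¬ SpansGaugeInvariantCylinders (d + 2) (wilsonLoopProducts so2Rep (d + 2)) := by
  intro h
  obtain ⟨W, hW, hclose⟩ := h (imPlaquette d) _ isCylinder_imPlaquette continuous_imPlaquette ⟨1, abs_imPlaquette_le⟩
    isZdGaugeInvariant_imPlaquette (1/2) (by norm_num)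
  have h1 := hclose (testConfig d)
  have h2 := hclose (testConfig d)⁻¹
  rw [imPlaquette_testConfig] at h1
  rw [imPlaquette_testConfig_inv, mem_span_wilsonLoopProducts_so2Rep_inv hW] at h2
  obtain ⟨h1a, h1b⟩ := abs_le.1 h1
  obtain ⟨h2a, h2b⟩ := abs_le.1 h2
  linarith

/-- **Consequently the several-variable schema fails for `so2Rep`** (contrapositive of the reduction theorem):
`¬ TraceWordsDense so2Rep`. [cite: Levy2004, §5] -/
theorem not_traceWordsDense_so2Rep : ¬ TraceWordsDense so2Rep := fun h =>
  not_spansGaugeInvariantCylinders_so2Rep (d := 0) (spansGaugeInvariantCylinders_of_traceWordsDense so2Rep h)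

end Negatives

end Literature.MathematicalPhysics.QuantumFieldTheory
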